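import Mathlib.SetTheory.Ordinal.Family
import Mathlib.Data.Nat.Size
import Mathlib.Data.Int.Interval
import Mathlib.Data.Set.Card
import Mathlib.RingTheory.Ideal.Span
import Literature.Algebra.EuclideanDomain.MotzkinConstruction
import Literature.Algebra.EuclideanDomain.UniversalSideDivisors
import HarnessLib

/-!
# The transfinite construction `(A_α)` and the smallest algorithm `θ` of a ring (Samuel 1971, §4)

Topic `Literature/Algebra/EuclideanDomain`, namespace `Literature.Algebra.EuclideanDomain`.  Two definitions
(`samuelSet R α` = Samuel's `A_α`, by well-founded recursion on the ordinals of the universe of `R`, and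
`samuelRank x` = Samuel's smallest algorithm `θ(x)`, the least `α` with `x ∈ A_α`); everything else PROVED; no named
fact, no instance, no notation.  This is the ordinal-indexed (transfinite) theory announced as missing in
`MotzkinConstruction.lean` («only the `ω`-indexed theory … the transfinite §2 is not») and in
`MinimalEuclideanFunctionSuperadditive.lean` (`TODO(general form)`): its finite stages are the complements of
Motzkin's sets, `A_n = R ∖ P₀^{(n)}` (`samuelSet_natCast`), and under Motzkin's criterion `θ = motzkinRank`
(`samuelRank_eq_natCast_motzkinRank`).

## Source (read at the page)

P. Samuel, *About Euclidean rings*, J. Algebra **19** (1971) 282–301 [Samuel1971] (materialised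
`paper:doi-10-1016-0021-8693-71-90110-4`, §4 «The smallest algorithm», pp. 288–291), VERBATIM.  Rings are commutative
with unit; an *algorithm* on `A` is a map `φ : A → W`, `W` well-ordered, with (E): for `a, b ∈ A`, `b ≠ 0`, there are
`q, r ∈ A` with `a = bq + r` and `φ(r) < φ(b)` (Definition 1, p. 282).
* **Proposition 9** (p. 288). «If `φ_α : A → W` is any nonempty family of algorithms on an Euclidean ring `A`, then
  `φ = inf_α φ_α` is also an algorithm.»  «Proposition 9 shows that the Euclidean ring `A` admits a smallest algorithm
  `θ` … Moreover we have `θ(x) = 0 ⟺ x = 0` (Prop. 1) (4.1); `θ(x) = 1 ⟺ x is a unit` (Prop. 2 and Cor. 1 to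
  Prop. 4) (4.2).»
* **Proposition 10** (pp. 288–289). «Let `θ : A → W` be the smallest algorithm on an Euclidean ring `A`.  For `α ∈ W`
  set `A_α = {x ∈ A | θ(x) ≤ α}` and `A_α′ = {x ∈ A | θ(x) < α}`.  Then `A_α` is the union of `{0}` and the set of
  all `b ∈ A` such that the canonical map `A_α′ → A/Ab` is surjective (i.e. representatives of the classes mod `Ab`
  can be found in `A_α′`).»  «Proposition 10 shows that the smallest algorithm can be constructed by transfinite
  induction, since the set `A_α′` determines `A_α` in a simple way.»  EXAMPLE (p. 289): «`θ(x) = 2` means that `A/Ax`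
  admits a system of representatives made of `0` and of units.  Such an `x` is necessarily a prime element of `A`
  (every nonzero element of `A/Ax` being invertible, `A/Ax` is a field).»
* **The transfinite construction** (p. 289). «Let `A` be a ring, and `W` an ordinal such that `card(A) < card(W)`.
  We set `A₀ = {0}`.  For `α > 0` in `W`, we define `A_α` by transfinite induction as follows: the set
  `A_α′ = ⋃_{β<α} A_β` is already defined and `A_α` is the union of `{0}` and of the set of all `b ∈ A` such that
  `A_α′ → A/Ab` is surjective.  It is clear that the sequence `(A_α)_{α∈W}` is increasing.  The ring `A` is Euclidean
  iff this sequence exhausts the ring `A`.  In this case the smallest algorithm `θ` on `A` is defined by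
  `θ(x) = α ⟺ x ∈ A_α − A_α′` (4.3).  Otherwise the sequence stops increasing before exhausting `A`.  At any rate
  we have `A₀ = {0}` (4.4), `A₁ − A₀ = A* =` set of units (4.5), `A₂ − A₁ = {b ∈ A | A/Ab admits a system of
  representatives made of 0 and of units}` (4.6).  The set `A₂ − A₁` may very well be empty (see the example of
  imaginary quadratic fields in Section 5); in this case `A` is not euclidean, unless it is a field.»
* EXAMPLES (1) (p. 289). «For `A = ℤ`, we have `A₁′ = A₁ = {−1, 0, +1}` … `A₂ = {−3, −2, −1, 0, 1, 2, 3}` … `A₃` is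
  the interval `[−7, +7]`, consisting of 15 consecutive integers.  An easy induction shows that the smallest algorithm
  `θ` on `ℤ` is given by `θ(n) =` number of binary digits of `|n|`.»
* **Proposition 11** (p. 290). «Let `A` be a ring, `T` a partially ordered set with descending chain condition and
  `φ : A → T` a mapping such that, given any `a` and `b ≠ 0` in `A`, there exist `q, r ∈ A` such that `a = bq + r`
  and `φ(r) < φ(b)`.  Then `A` is Euclidean.»  (Proof: if `A′ = ⋃_α A_α ≠ A`, choose `b ∈ A − A′` with `φ(b)`
  minimal; then `φ(r) < φ(b)` implies `r ∈ A′`, so that `A′ → A/Ab` is surjective, hence `b ∈ A′`, a contradiction.)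

## What is formalised (dictionary)

* `samuelSet R : Ordinal.{u} → Set R` for `R : Type u` — the construction over «an ordinal `W` with
  `card(A) < card(W)`» is realised over ALL ordinals of the universe of `R` (the sequence is stationary from some
  `τ` on, `exists_samuelSet_add_one_eq` / `samuelSet_eq_of_add_one_eq`, by `not_injective_of_ordinal`).  The
  surjectivity «`A_α′ → A/Ab`» is written `∀ a, ∃ β < α, ∃ r ∈ A_β, b ∣ a − r`.  (4.4) `samuelSet_zero`, «increasing»
  `samuelSet_mono`, the successor step `samuelSet_add_one`, (4.5) `samuelSet_one`, (4.6) `samuelSet_two` /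
  `mem_samuelSet_two_and_not_mem_one_iff` (in the tree's words: `A₂ − A₁` = the universal side divisors,
  `IsUniversalSideDivisor`), `samuelSet_omega0`; finite stages `samuelSet_natCast : A_n = (P₀^{(n)})ᶜ`.
* «exhausts the ring» is `∀ x, ∃ α, x ∈ samuelSet R α`, equivalently `∃ α, samuelSet R α = univ`
  (`exists_samuelSet_eq_univ_iff`).  **Proposition 11** is `exists_mem_samuelSet_of_algorithm`, for ANY type `T` with a
  well-founded `<` (in any universe) — so in particular for every well-ordered `W`; THE CRITERION «Euclidean iff the
  sequence exhausts `A`» is `exists_algorithm_iff_forall_exists_mem_samuelSet` (algorithms valued in `Ordinal.{u}`;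
  `exists_ordinal_algorithm_of_algorithm` moves any well-founded value type to `Ordinal.{u}`).
* `samuelRank x = sInf {α | x ∈ samuelSet R α}` is `θ` (value `0` off `⋃_α A_α`, where Samuel leaves `θ` undefined;
  the lemmas carry the hypothesis `∃ α, x ∈ samuelSet R α` or global exhaustion where needed): (4.3)
  `samuelRank_eq_iff`, (4.1) `samuelRank_eq_zero_iff`, (4.2) `samuelRank_eq_one_iff`, `samuelRank_eq_two_iff` (+ the
  EXAMPLE: `isMaximal_span_singleton_of_samuelRank_eq_two`, `prime_of_samuelRank_eq_two`), (E) for `θ`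
  (`exists_remainder_samuelRank_lt`, `samuelRank_isAlgorithm`), **Proposition 10** (`setOf_samuelRank_le_eq`,
  `setOf_samuelRank_le_eq_setOf_forall`), «the smallest algorithm» (`samuelRank_le_apply` for ordinal-valued
  algorithms, `samuelRank_le_natCast` for `ℕ`-valued ones, `samuelRank_le_typein` for a well-ordered `W : Type u`, all
  from `mem_samuelSet_of_algorithm`), and Prop. 4 (a)/(b) for `θ` («`θ` enjoys the properties described in Prop. 4»):
  `samuelRank_le_samuelRank_mul`, `samuelRank_mul_eq_iff`.
* **Proposition 9** for a family of algorithms with values in one conditionally complete well-ordered type: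
  `algorithm_iInf`.  «not euclidean, unless it is a field»: `isUnit_of_algorithm_of_forall_not_isUniversalSideDivisor`.
* `ℤ`: `Int.samuelSet_natCast_eq` (`A_n = {b | |b| < 2ⁿ}`), `Int.samuelSet_one_eq` / `_two_eq` / `_three_eq` (the three
  displayed sets, `ncard A₃ = 15`), `Int.samuelSet_omega0`, **`Int.samuelRank_eq`** («`θ(n)` = number of binary digits
  of `|n|`», `Nat.size`).
* Remark (no declaration): Conidis–Nielsen–Tombs 2019 index the same construction as `S_α(R)` with `S₀ = units` and
  `0` adjoined only at the end; for `x ≠ 0`, `x ∈ S_α ⟺ x ∈ A_{1+α}`, so their minimal norm `τ` is Motzkin's `|·|`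
  and Samuel's `θ = 1 + τ` on non-zero elements (as `motzkinRank = motzkinNorm + 1` in the finite theory).
-- TODO(general form): Samuel's remark (F) (finiteness of the finite stages when `A*` is finite, via Prop. 13) and
-- «isomorphic algorithms» are not formalised.

## Mathlib / tree search

Mathlib: `WellFoundedLT.fix`/`fix_eq` (recursion on ordinals), `Ordinal.le_iSup`, `not_injective_of_ordinal`,
`csInf_mem`/`csInf_le'` (ordinals), `Ordinal.typein`, `Nat.size`; no Euclidean-ring material beyond `EuclideanDomain`.
Tree (`lean search`/`rg` «Ordinal» in `Literature/Algebra/EuclideanDomain` → nothing): `motzkinSet`, `motzkinRank`,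
`not_mem_motzkinSet_motzkinRank`, `mem_motzkinSet_of_lt_motzkinRank`, `Int.motzkinSet_eq`,
`Int.forall_exists_not_mem_motzkinSet`, `exists_euclideanFunction_iff_forall_exists_not_mem_motzkinSet`
(`MotzkinConstruction.lean`); `IsUniversalSideDivisor` (+ `isMaximal_span`, `prime`; `UniversalSideDivisors.lean`);
Samuel §2 for transfinite-valued algorithms is `NormalisedEuclideanAlgorithm.lean`, Prop. 6 for `ℤ × ℤ` is
`IntProdIntTransfiniteEuclidean.lean` (whose docstrings already call `(P₀^{(k)})ᶜ` the stages `A_k`); the pattern of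
an ordinal-indexed family by `IsWellFounded.fix` is the one of `Literature/Algebra/Module/GeneralizedHeights.lean`.
-/

namespace Literature.Algebra.EuclideanDomain

universe u

/-! ## §1 Proposition 9: the infimum of a family of algorithms -/

section PropNine

variable {R : Type u} [CommRing R]

/-- **Proposition 9.** «If `φ_α : A → W` is any nonempty family of algorithms on an Euclidean ring `A`, then
`φ = inf_α φ_α` is also an algorithm» (since `W` is well ordered, `φ(b) = φ_i(b)` for a suitable index `i`; write
`a = bq + r` with `φ_i(r) < φ_i(b)`, then `φ(r) ≤ φ_i(r) < φ_i(b) = φ(b)`).  Here `W` is a conditionally complete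
linear order with well-founded `<` (e.g. `ℕ`, or the ordinals), so that `⨅ i, φ i x` is the pointwise infimum.
[cite: Samuel1971, Prop. 9 (p. 288)] -/
theorem algorithm_iInf {ι : Type*} [Nonempty ι] {W : Type*} [ConditionallyCompleteLinearOrder W] [WellFoundedLT W]
    {φ : ι → R → W} (hφ : ∀ i, ∀ a b : R, b ≠ 0 → ∃ q r : R, a = b * q + r ∧ φ i r < φ i b) :
    ∀ a b : R, b ≠ 0 → ∃ q r : R, a = b * q + r ∧ (⨅ i, φ i r) < ⨅ i, φ i b := by
  intro a b hb
  obtain ⟨i, hi⟩ := ciInf_mem fun i ↦ φ i b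
  obtain ⟨q, r, hqr, hr⟩ := hφ i a b hb
  refine ⟨q, r, hqr, ?_⟩
  haveI : Nonempty W := ⟨φ i b⟩
  letI : OrderBot W := WellFoundedLT.toOrderBot W
  calc (⨅ j, φ j r) ≤ φ i r := ciInf_le ⟨⊥, fun _ _ ↦ bot_le⟩ i
    _ < φ i b := hr
    _ = ⨅ j, φ j b := hi

end PropNine

/-! ## §2 The transfinite construction `A₀ ⊆ A₁ ⊆ ⋯ ⊆ A_α ⊆ ⋯` -/

section Construction

variable (R : Type u) [CommRing R]

/-- **Samuel's transfinite construction** `(A_α)_α`: «We set `A₀ = {0}`.  For `α > 0` … the set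
`A_α′ = ⋃_{β<α} A_β` is already defined and `A_α` is the union of `{0}` and of the set of all `b ∈ A` such that
`A_α′ → A/Ab` is surjective» — i.e. every class `a + Ab` has a representative `r ∈ A_β` for some `β < α`
(`b ∣ a − r`).  Defined by well-founded recursion over all ordinals of the universe of `R` (one formula for every `α`,
which at `α = 0` gives `{0}`). [cite: Samuel1971, §4 «The transfinite construction» (p. 289)] -/
def samuelSet : Ordinal.{u} → Set R :=
  WellFoundedLT.fix fun α A ↦
    {b : R | b = 0 ∨ ∀ a : R, ∃ (β : Ordinal.{u}) (h : β < α), ∃ r ∈ A β h, b ∣ a - r}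

variable {R}

/-- The recursion, unfolded: `A_α = {0} ∪ {b | every class mod `Ab` meets `⋃_{β<α} A_β}`.
[cite: Samuel1971, §4 «The transfinite construction» (p. 289)] -/
theorem samuelSet_def (α : Ordinal.{u}) :
    samuelSet R α = {b : R | b = 0 ∨ ∀ a : R, ∃ β < α, ∃ r ∈ samuelSet R β, b ∣ a - r} := by
  unfold samuelSet
  rw [WellFoundedLT.fix_eq]
  simp only [exists_prop]

/-- Membership in `A_α`. [cite: Samuel1971, §4 «The transfinite construction» (p. 289)] -/
theorem mem_samuelSet_iff {α : Ordinal.{u}} {b : R} :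
    b ∈ samuelSet R α ↔ b = 0 ∨ ∀ a : R, ∃ β < α, ∃ r ∈ samuelSet R β, b ∣ a - r := by
  rw [samuelSet_def]; rfl

/-- `0 ∈ A_α` for every `α` («the union of `{0}` and …»). [cite: Samuel1971, §4 (p. 289)] -/
theorem zero_mem_samuelSet (α : Ordinal.{u}) : (0 : R) ∈ samuelSet R α :=
  mem_samuelSet_iff.2 (Or.inl rfl)

/-- If `A_α′ → A/Ab` is surjective then `b ∈ A_α`. [cite: Samuel1971, §4 (p. 289)] -/
theorem mem_samuelSet_of_forall {α : Ordinal.{u}} {b : R}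
    (h : ∀ a : R, ∃ β < α, ∃ r ∈ samuelSet R β, b ∣ a - r) : b ∈ samuelSet R α :=
  mem_samuelSet_iff.2 (Or.inr h)

/-- For `b ≠ 0` in `A_α`, `A_α′ → A/Ab` is surjective. [cite: Samuel1971, §4 (p. 289)] -/
theorem forall_of_mem_samuelSet {α : Ordinal.{u}} {b : R} (hb : b ∈ samuelSet R α) (h0 : b ≠ 0) :
    ∀ a : R, ∃ β < α, ∃ r ∈ samuelSet R β, b ∣ a - r :=
  (mem_samuelSet_iff.1 hb).resolve_left h0

/-- **(4.4)** «`A₀ = {0}`». [cite: Samuel1971, §4 (4.4) (p. 289)] -/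
theorem samuelSet_zero : samuelSet R 0 = {0} := by
  ext b
  rw [mem_samuelSet_iff, Set.mem_singleton_iff, or_iff_left]
  intro h
  obtain ⟨β, hβ, -⟩ := h 0
  exact not_lt_bot hβ

/-- «It is clear that the sequence `(A_α)` is increasing.» [cite: Samuel1971, §4 (p. 289)] -/
theorem samuelSet_mono : Monotone (samuelSet R) := by
  intro β α hβα b hb
  rcases mem_samuelSet_iff.1 hb with rfl | h
  · exact zero_mem_samuelSet α
  · exact mem_samuelSet_of_forall fun a ↦ by
      obtain ⟨γ, hγ, r, hr, hd⟩ := h a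
      exact ⟨γ, hγ.trans_le hβα, r, hr, hd⟩

/-- The successor step: `A_{α+1} = {0} ∪ {b | A_α → A/Ab is surjective}` (as `A_{α+1}′ = A_α`, the sequence being
increasing). [cite: Samuel1971, §4 (p. 289)] -/
theorem samuelSet_add_one (α : Ordinal.{u}) :
    samuelSet R (α + 1) = {b : R | b = 0 ∨ ∀ a : R, ∃ r ∈ samuelSet R α, b ∣ a - r} := by
  ext b
  rw [mem_samuelSet_iff, Set.mem_setOf_eq]
  refine or_congr_right (forall_congr' fun a ↦ ⟨?_, ?_⟩)
  · rintro ⟨β, hβ, r, hr, hd⟩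
    exact ⟨r, samuelSet_mono (Order.lt_add_one_iff.1 hβ) hr, hd⟩
  · rintro ⟨r, hr, hd⟩
    exact ⟨α, lt_add_one α, r, hr, hd⟩

/-- `A_{α+1} = A_α ∪ {b | A_α → A/Ab is surjective}` — the form used for the finite stages in
`IntProdIntTransfiniteEuclidean.lean`. [cite: Samuel1971, §4 (p. 289)] -/
theorem mem_samuelSet_add_one_iff {α : Ordinal.{u}} {b : R} :
    b ∈ samuelSet R (α + 1) ↔ b ∈ samuelSet R α ∨ ∀ a : R, ∃ r ∈ samuelSet R α, b ∣ a - r := by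
  rw [samuelSet_add_one, Set.mem_setOf_eq]
  constructor
  · rintro (rfl | h)
    · exact Or.inl (zero_mem_samuelSet α)
    · exact Or.inr h
  · rintro (h | h)
    · by_cases hb : b = 0
      · exact Or.inl hb
      · exact Or.inr fun a ↦ by
          obtain ⟨β, hβ, r, hr, hd⟩ := forall_of_mem_samuelSet h hb a
          exact ⟨r, samuelSet_mono hβ.le hr, hd⟩
    · exact Or.inr h

/-- **(4.5)** «`A₁ − A₀ = A*` = set of units»: `A₁ = {0} ∪ A*` (`b` divides every `a − 0` iff `b` is a unit).
[cite: Samuel1971, §4 (4.5) (p. 289)] -/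
theorem samuelSet_one : samuelSet R 1 = {b : R | b = 0 ∨ IsUnit b} := by
  have h1 : (1 : Ordinal.{u}) = 0 + 1 := (zero_add 1).symm
  rw [h1, samuelSet_add_one, samuelSet_zero]
  ext b
  simp only [Set.mem_setOf_eq, Set.mem_singleton_iff, exists_eq_left, sub_zero]
  rw [isUnit_iff_forall_dvd]

/-- **(4.6)** «`A₂ − A₁ = {b ∈ A | A/Ab admits a system of representatives made of 0 and of units}`»:
`A₂ = {0} ∪ A* ∪ {universal side divisors}`. [cite: Samuel1971, §4 (4.6) (p. 289)] -/
theorem samuelSet_two : samuelSet R 2 = {b : R | b = 0 ∨ IsUnit b ∨ IsUniversalSideDivisor b} := by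
  rw [← one_add_one_eq_two, samuelSet_add_one, samuelSet_one]
  ext b
  simp only [Set.mem_setOf_eq]
  by_cases hb : b = 0
  · simp only [hb, true_or]
  rw [or_iff_right hb, or_iff_right hb]
  constructor
  · intro h
    by_cases hu : IsUnit b
    · exact Or.inl hu
    · exact Or.inr ⟨hb, hu, fun x ↦ by
        obtain ⟨r, hr, hd⟩ := h x
        exact ⟨r, hr, hd⟩⟩
  · rintro (hu | husd) a
    · exact ⟨0, Or.inl rfl, by rw [sub_zero]; exact hu.dvd⟩
    · obtain ⟨z, hz, hd⟩ := husd.2.2 a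
      exact ⟨z, hz, hd⟩

/-- (4.6) in the tree's words: `b ∈ A₂ − A₁` iff `b` is a universal side divisor (`IsUniversalSideDivisor`: `b ≠ 0`,
not a unit, and every class mod `b` contains `0` or a unit). [cite: Samuel1971, §4 (4.6) (p. 289)] -/
theorem mem_samuelSet_two_and_not_mem_one_iff {b : R} :
    b ∈ samuelSet R 2 ∧ b ∉ samuelSet R 1 ↔ IsUniversalSideDivisor b := by
  rw [samuelSet_two, samuelSet_one]
  simp only [Set.mem_setOf_eq, not_or]
  constructor
  · rintro ⟨h | h | h, h0, hu⟩
    · exact absurd h h0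
    · exact absurd h hu
    · exact h
  · intro h
    exact ⟨Or.inr (Or.inr h), h.ne_zero, h.not_isUnit⟩

/-- The stage `ω`: `A_ω = {0} ∪ {b | every class mod `Ab` meets some finite stage `A_n`}`.
[cite: Samuel1971, §4 (p. 289)] -/
theorem samuelSet_omega0 :
    samuelSet R Ordinal.omega0 =
      {b : R | b = 0 ∨ ∀ a : R, ∃ n : ℕ, ∃ r ∈ samuelSet R n, b ∣ a - r} := by
  ext b
  rw [mem_samuelSet_iff, Set.mem_setOf_eq]
  refine or_congr_right (forall_congr' fun a ↦ ⟨?_, ?_⟩)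
  · rintro ⟨β, hβ, r, hr, hd⟩
    obtain ⟨n, rfl⟩ := Ordinal.lt_omega0.1 hβ
    exact ⟨n, r, hr, hd⟩
  · rintro ⟨n, r, hr, hd⟩
    exact ⟨n, Ordinal.natCast_lt_omega0 n, r, hr, hd⟩

/-- The finite stages lie in `A_ω`. [cite: Samuel1971, §4 (p. 289)] -/
theorem iUnion_samuelSet_natCast_subset :
    (⋃ n : ℕ, samuelSet R n) ⊆ samuelSet R Ordinal.omega0 :=
  Set.iUnion_subset fun n ↦ samuelSet_mono (Ordinal.natCast_lt_omega0 n).le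

/-- «the sequence stops increasing»: there is an ordinal `τ` (of the universe of `R`) with `A_{τ+1} = A_τ` — a strictly
increasing family of subsets of `R` indexed by all ordinals cannot exist; this replaces Samuel's choice of «an ordinal
`W` such that `card(A) < card(W)`». [cite: Samuel1971, §4 (p. 289)] -/
theorem exists_samuelSet_add_one_eq : ∃ τ : Ordinal.{u}, samuelSet R (τ + 1) = samuelSet R τ := by
  by_contra h
  push Not at h
  apply not_injective_of_ordinal (samuelSet R)
  have hsm : StrictMono (samuelSet R) := fun α β hαβ ↦
    lt_of_lt_of_le (lt_of_le_of_ne (samuelSet_mono (lt_add_one α).le) (h α).symm)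
      (samuelSet_mono (Order.add_one_le_iff.2 hαβ))
  exact hsm.injective

/-- Once `A_{τ+1} = A_τ` the sequence is constant from `τ` on. [cite: Samuel1971, §4 (p. 289)] -/
theorem samuelSet_eq_of_add_one_eq {τ : Ordinal.{u}} (hτ : samuelSet R (τ + 1) = samuelSet R τ)
    {α : Ordinal.{u}} (hα : τ ≤ α) : samuelSet R α = samuelSet R τ := by
  induction α using WellFoundedLT.induction with
  | ind α ih =>
    refine le_antisymm ?_ (samuelSet_mono hα)
    intro b hb
    rw [← hτ, samuelSet_add_one]
    rcases mem_samuelSet_iff.1 hb with rfl | h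
    · exact Or.inl rfl
    · refine Or.inr fun a ↦ ?_
      obtain ⟨β, hβ, r, hr, hd⟩ := h a
      refine ⟨r, ?_, hd⟩
      rcases le_or_gt β τ with hβτ | hτβ
      · exact samuelSet_mono hβτ hr
      · rw [← ih β hβ hτβ.le]
        exact hr

/-- If `A₂ = A₁` — no universal side divisor — the sequence is constant from `A₁ = {0} ∪ A*` on («The set `A₂ − A₁`
may very well be empty … in this case `A` is not euclidean, unless it is a field»).
[cite: Samuel1971, §4 (p. 289)] -/
theorem samuelSet_eq_samuelSet_one_of_forall_not_isUniversalSideDivisor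
    (h : ∀ b : R, ¬IsUniversalSideDivisor b) {α : Ordinal.{u}} (hα : 1 ≤ α) :
    samuelSet R α = samuelSet R 1 := by
  refine samuelSet_eq_of_add_one_eq ?_ hα
  rw [one_add_one_eq_two, samuelSet_two, samuelSet_one]
  ext b
  simp only [Set.mem_setOf_eq, h b, or_false]

/-- «exhausts the ring» as a single stage: `⋃_α A_α = A` iff `A_α = A` for some `α` (take the supremum of the stages of
the elements, an ordinal of the universe of `R`). [cite: Samuel1971, §4 (p. 289)] -/
theorem exists_samuelSet_eq_univ_iff :
    (∃ α : Ordinal.{u}, samuelSet R α = Set.univ) ↔ ∀ x : R, ∃ α : Ordinal.{u}, x ∈ samuelSet R α := by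
  constructor
  · rintro ⟨α, hα⟩ x
    exact ⟨α, hα ▸ Set.mem_univ x⟩
  · intro h
    choose f hf using h
    exact ⟨⨆ x, f x, Set.eq_univ_of_forall fun x ↦ samuelSet_mono (Ordinal.le_iSup f x) (hf x)⟩

/-! ## §3 Proposition 11: an algorithm with values in any well-founded order exhausts the ring -/

/-- `A′ = ⋃_α A_α` is closed under the construction: if every class mod `Ab` has a representative in `A′`, then
`b ∈ A′` (the representatives lie in stages `A_{β_a}`, and `b ∈ A_α` for `α = sup_a (β_a + 1)`).  This is the step
«`A′ → A/Ab` is surjective.  But this implies `b ∈ A′`» of the proof of Prop. 11. [cite: Samuel1971, Prop. 11 (p. 290)] -/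
theorem mem_iUnion_samuelSet_of_forall {b : R}
    (h : ∀ a : R, ∃ r ∈ ⋃ α : Ordinal.{u}, samuelSet R α, b ∣ a - r) :
    b ∈ ⋃ α : Ordinal.{u}, samuelSet R α := by
  choose r hr hd using h
  simp only [Set.mem_iUnion] at hr ⊢
  choose f hf using hr
  exact ⟨⨆ a, (f a + 1), mem_samuelSet_of_forall fun a ↦
    ⟨f a, (lt_add_one (f a)).trans_le (Ordinal.le_iSup (fun a ↦ f a + 1) a), r a, hf a, hd a⟩⟩

/-- **Proposition 11.** «Let `A` be a ring, `T` a partially ordered set with descending chain condition and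
`φ : A → T` a mapping such that, given any `a` and `b ≠ 0` in `A`, there exist `q, r ∈ A` such that `a = bq + r` and
`φ(r) < φ(b)`.  Then `A` is Euclidean» — i.e. the transfinite construction exhausts `A` (by well-founded induction on
`φ(b)`: all remainders mod `b` lie in `A′`, hence so does `b`).  Stated for any type `T` with a well-founded `<`, in any
universe; in particular for algorithms with values in any well-ordered set. [cite: Samuel1971, Prop. 11 (p. 290)] -/
theorem exists_mem_samuelSet_of_algorithm {T : Type*} [LT T] [WellFoundedLT T] (φ : R → T)
    (hφ : ∀ a b : R, b ≠ 0 → ∃ q r : R, a = b * q + r ∧ φ r < φ b) (x : R) :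
    ∃ α : Ordinal.{u}, x ∈ samuelSet R α := by
  have hwf : WellFounded fun x y : R ↦ φ x < φ y := InvImage.wf φ wellFounded_lt
  refine hwf.induction (C := fun x ↦ ∃ α : Ordinal.{u}, x ∈ samuelSet R α) x fun b ih ↦ ?_
  by_cases hb : b = 0
  · exact ⟨0, hb ▸ zero_mem_samuelSet 0⟩
  · have H : b ∈ ⋃ α : Ordinal.{u}, samuelSet R α := by
      refine mem_iUnion_samuelSet_of_forall fun a ↦ ?_
      obtain ⟨q, r, hqr, hr⟩ := hφ a b hb
      obtain ⟨α, hα⟩ := ih r hr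
      exact ⟨r, Set.mem_iUnion.2 ⟨α, hα⟩, ⟨q, by rw [hqr]; ring⟩⟩
    exact Set.mem_iUnion.1 H

/-- Proposition 11 as a single stage: a ring with an algorithm (values in any well-founded order) has `A_α = A` for
some ordinal `α` of its universe. [cite: Samuel1971, Prop. 11 (p. 290)] -/
theorem exists_samuelSet_eq_univ_of_algorithm {T : Type*} [LT T] [WellFoundedLT T] (φ : R → T)
    (hφ : ∀ a b : R, b ≠ 0 → ∃ q r : R, a = b * q + r ∧ φ r < φ b) :
    ∃ α : Ordinal.{u}, samuelSet R α = Set.univ :=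
  exists_samuelSet_eq_univ_iff.2 (exists_mem_samuelSet_of_algorithm φ hφ)

/-- «in this case `A` is not euclidean, unless it is a field»: if `A` has no universal side divisor and carries an
algorithm (values in any well-founded order), then every non-zero element of `A` is a unit.
[cite: Samuel1971, §4 (p. 289)] -/
theorem isUnit_of_algorithm_of_forall_not_isUniversalSideDivisor {T : Type*} [LT T] [WellFoundedLT T]
    (φ : R → T) (hφ : ∀ a b : R, b ≠ 0 → ∃ q r : R, a = b * q + r ∧ φ r < φ b)
    (h : ∀ b : R, ¬IsUniversalSideDivisor b) {x : R} (hx : x ≠ 0) : IsUnit x := by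
  obtain ⟨α, hα⟩ := exists_mem_samuelSet_of_algorithm φ hφ x
  have hx1 : x ∈ samuelSet R 1 := by
    rcases le_or_gt 1 α with h1 | h1
    · rwa [samuelSet_eq_samuelSet_one_of_forall_not_isUniversalSideDivisor h h1] at hα
    · rw [Order.lt_one_iff] at h1
      rw [h1, samuelSet_zero] at hα
      exact absurd hα hx
  rw [samuelSet_one] at hx1
  exact hx1.resolve_left hx

end Construction

/-! ## §4 The smallest algorithm `θ` -/

section Rank

variable {R : Type u} [CommRing R]

/-- **The smallest algorithm** `θ`: «`θ(x) = α ⟺ x ∈ A_α − A_α′`» (4.3), i.e. the least `α` with `x ∈ A_α` (and the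
junk value `0` if there is none — Samuel defines `θ` only when the sequence exhausts the ring).
[cite: Samuel1971, §4 (4.3) (p. 289)] -/
noncomputable def samuelRank (x : R) : Ordinal.{u} := sInf {α : Ordinal.{u} | x ∈ samuelSet R α}

/-- `x ∈ A_{θ(x)}` as soon as `x` lies in some stage. [cite: Samuel1971, §4 (4.3) (p. 289)] -/
theorem mem_samuelSet_samuelRank {x : R} (hx : ∃ α : Ordinal.{u}, x ∈ samuelSet R α) :
    x ∈ samuelSet R (samuelRank x) :=
  csInf_mem hx

/-- `θ(x) ≤ α` for `x ∈ A_α`. [cite: Samuel1971, §4 (4.3) (p. 289)] -/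
theorem samuelRank_le_of_mem {x : R} {α : Ordinal.{u}} (h : x ∈ samuelSet R α) : samuelRank x ≤ α :=
  csInf_le' h

/-- `x ∉ A_α` for `α < θ(x)`. [cite: Samuel1971, §4 (4.3) (p. 289)] -/
theorem not_mem_samuelSet_of_lt_samuelRank {x : R} {α : Ordinal.{u}} (h : α < samuelRank x) :
    x ∉ samuelSet R α :=
  fun hx ↦ lt_irrefl _ ((samuelRank_le_of_mem hx).trans_lt h)

/-- If `θ(x) ≠ 0` then `x` lies in some stage (the junk value is `0 = sInf ∅`). [cite: Samuel1971, §4 (4.3) (p. 289)] -/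
theorem exists_mem_samuelSet_of_samuelRank_ne_zero {x : R} (h : samuelRank x ≠ 0) :
    ∃ α : Ordinal.{u}, x ∈ samuelSet R α := by
  by_contra hne
  push Not at hne
  apply h
  have : {α : Ordinal.{u} | x ∈ samuelSet R α} = ∅ := Set.eq_empty_of_forall_notMem fun α ↦ hne α
  rw [samuelRank, this, Ordinal.sInf_empty]

/-- For `x ∈ A′`: `x ∈ A_α ⟺ θ(x) ≤ α`, i.e. «`A_α = {x ∈ A | θ(x) ≤ α}`» elementwise.
[cite: Samuel1971, Prop. 10 (p. 288)] -/
theorem mem_samuelSet_iff_samuelRank_le {x : R} {α : Ordinal.{u}} (hx : ∃ β : Ordinal.{u}, x ∈ samuelSet R β) :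
    x ∈ samuelSet R α ↔ samuelRank x ≤ α :=
  ⟨samuelRank_le_of_mem, fun h ↦ samuelSet_mono h (mem_samuelSet_samuelRank hx)⟩

/-- **(4.3)** «`θ(x) = α ⟺ x ∈ A_α − A_α′`» (`A_α′ = ⋃_{β<α} A_β`). [cite: Samuel1971, §4 (4.3) (p. 289)] -/
theorem samuelRank_eq_iff {x : R} {α : Ordinal.{u}} (hx : ∃ β : Ordinal.{u}, x ∈ samuelSet R β) :
    samuelRank x = α ↔ x ∈ samuelSet R α ∧ ∀ β < α, x ∉ samuelSet R β := by
  constructor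
  · rintro rfl
    exact ⟨mem_samuelSet_samuelRank hx, fun β hβ ↦ not_mem_samuelSet_of_lt_samuelRank hβ⟩
  · rintro ⟨h1, h2⟩
    exact le_antisymm (samuelRank_le_of_mem h1)
      (not_lt.1 fun hlt ↦ h2 _ hlt (mem_samuelSet_samuelRank hx))

/-- `θ(0) = 0`. [cite: Samuel1971, §4 (4.1) (p. 288)] -/
theorem samuelRank_zero : samuelRank (0 : R) = 0 :=
  le_antisymm (samuelRank_le_of_mem (zero_mem_samuelSet 0)) bot_le

/-- **(4.1)** «`θ(x) = 0 ⟺ x = 0`». [cite: Samuel1971, §4 (4.1) (p. 288)] -/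
theorem samuelRank_eq_zero_iff {x : R} (hx : ∃ β : Ordinal.{u}, x ∈ samuelSet R β) :
    samuelRank x = 0 ↔ x = 0 := by
  rw [samuelRank_eq_iff hx, samuelSet_zero, Set.mem_singleton_iff, and_iff_left]
  exact fun β hβ ↦ absurd hβ not_lt_bot

/-- `θ(x) > 0` for `x ≠ 0` in `A′`. [cite: Samuel1971, §4 (4.1) (p. 288)] -/
theorem samuelRank_pos {x : R} (hx : ∃ β : Ordinal.{u}, x ∈ samuelSet R β) (h0 : x ≠ 0) :
    0 < samuelRank x :=
  pos_iff_ne_zero.2 fun h ↦ h0 ((samuelRank_eq_zero_iff hx).1 h)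

/-- **(4.2)** «`θ(x) = 1 ⟺ x` is a unit» — with `x ≠ 0` recorded, which Samuel's statement presupposes (in the zero
ring `0` is a unit with `θ(0) = 0`). [cite: Samuel1971, §4 (4.2) (p. 288)] -/
theorem samuelRank_eq_one_iff {x : R} : samuelRank x = 1 ↔ x ≠ 0 ∧ IsUnit x := by
  constructor
  · intro h
    have hx := exists_mem_samuelSet_of_samuelRank_ne_zero (R := R) (by rw [h]; exact one_ne_zero)
    obtain ⟨h1, h2⟩ := (samuelRank_eq_iff hx).1 h
    have h0 : x ≠ 0 := by
      rintro rfl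
      exact h2 0 zero_lt_one (zero_mem_samuelSet 0)
    rw [samuelSet_one] at h1
    exact ⟨h0, h1.resolve_left h0⟩
  · rintro ⟨h0, hu⟩
    have h1 : x ∈ samuelSet R 1 := by
      rw [samuelSet_one]
      exact Or.inr hu
    refine (samuelRank_eq_iff ⟨1, h1⟩).2 ⟨h1, fun β hβ ↦ ?_⟩
    rw [Order.lt_one_iff] at hβ
    rw [hβ, samuelSet_zero]
    exact h0

/-- In a non-trivial ring: `θ(x) = 1 ⟺ x` is a unit. [cite: Samuel1971, §4 (4.2) (p. 288)] -/
theorem samuelRank_eq_one_iff_isUnit [Nontrivial R] {x : R} : samuelRank x = 1 ↔ IsUnit x := by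
  rw [samuelRank_eq_one_iff]
  exact ⟨fun h ↦ h.2, fun h ↦ ⟨h.ne_zero, h⟩⟩

/-- (4.6) for `θ`: `θ(x) = 2` iff `x` is a universal side divisor («`A/Ax` admits a system of representatives made of
`0` and of units», `x` not `0`, not a unit). [cite: Samuel1971, §4 (4.6) and Example (p. 289)] -/
theorem samuelRank_eq_two_iff {x : R} : samuelRank x = 2 ↔ IsUniversalSideDivisor x := by
  constructor
  · intro h
    have hx := exists_mem_samuelSet_of_samuelRank_ne_zero (R := R) (by rw [h]; exact two_ne_zero)
    obtain ⟨h2, hlt⟩ := (samuelRank_eq_iff hx).1 h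
    exact mem_samuelSet_two_and_not_mem_one_iff.1 ⟨h2, hlt 1 one_lt_two⟩
  · intro h
    obtain ⟨h2, h1⟩ := mem_samuelSet_two_and_not_mem_one_iff.2 h
    refine (samuelRank_eq_iff ⟨2, h2⟩).2 ⟨h2, fun β hβ hβx ↦ h1 (samuelSet_mono ?_ hβx)⟩
    rw [← one_add_one_eq_two] at hβ
    exact Order.lt_add_one_iff.1 hβ

/-- EXAMPLE: «`θ(x) = 2` … Such an `x` is necessarily a prime element of `A` (… `A/Ax` is a field)» — the ideal `Ax` is
maximal. [cite: Samuel1971, §4 Example (p. 289)] -/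
theorem isMaximal_span_singleton_of_samuelRank_eq_two {x : R} (h : samuelRank x = 2) :
    (Ideal.span {x}).IsMaximal :=
  (samuelRank_eq_two_iff.1 h).isMaximal_span

/-- EXAMPLE (domain case): «Such an `x` is necessarily a prime element of `A`». [cite: Samuel1971, §4 Example (p. 289)] -/
theorem prime_of_samuelRank_eq_two [IsDomain R] {x : R} (h : samuelRank x = 2) : Prime x :=
  (samuelRank_eq_two_iff.1 h).prime

/-- Division with remainder inside the construction: for `b ≠ 0` in `A_α` every `a` is `bq + r` with `r ∈ A_β`,
`β < α`. [cite: Samuel1971, §4 (p. 289)] -/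
theorem exists_remainder_mem_samuelSet {b : R} {α : Ordinal.{u}} (hb : b ∈ samuelSet R α) (h0 : b ≠ 0) (a : R) :
    ∃ q r : R, ∃ β < α, r ∈ samuelSet R β ∧ a = b * q + r := by
  obtain ⟨β, hβ, r, hr, c, hc⟩ := forall_of_mem_samuelSet hb h0 a
  exact ⟨c, r, β, hβ, hr, by rw [← hc]; ring⟩

/-- **`θ` satisfies (E)**: for `b ≠ 0` in `A′`, every `a` is `bq + r` with `θ(r) < θ(b)` («In this case the smallest
algorithm `θ` on `A` is defined by (4.3)»). [cite: Samuel1971, §4 (4.3) (p. 289)] -/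
theorem exists_remainder_samuelRank_lt {b : R} (hb : ∃ α : Ordinal.{u}, b ∈ samuelSet R α) (h0 : b ≠ 0)
    (a : R) : ∃ q r : R, a = b * q + r ∧ samuelRank r < samuelRank b := by
  obtain ⟨q, r, β, hβ, hr, hqr⟩ := exists_remainder_mem_samuelSet (mem_samuelSet_samuelRank hb) h0 a
  exact ⟨q, r, hqr, (samuelRank_le_of_mem hr).trans_lt hβ⟩

/-- If the sequence exhausts the ring, `θ` is an algorithm (values in the ordinals of the universe of `R`).
[cite: Samuel1971, §4 (4.3) (p. 289)] -/
theorem samuelRank_isAlgorithm (h : ∀ x : R, ∃ α : Ordinal.{u}, x ∈ samuelSet R α) :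
    ∀ a b : R, b ≠ 0 → ∃ q r : R, a = b * q + r ∧ samuelRank r < samuelRank b :=
  fun a b hb ↦ exists_remainder_samuelRank_lt (h b) hb a

/-- **Proposition 10**, first clause: for the smallest algorithm, «`A_α = {x ∈ A | θ(x) ≤ α}`» IS the `α`-th stage
of the transfinite construction. [cite: Samuel1971, Prop. 10 (pp. 288–289)] -/
theorem setOf_samuelRank_le_eq (h : ∀ x : R, ∃ α : Ordinal.{u}, x ∈ samuelSet R α) (α : Ordinal.{u}) :
    {x : R | samuelRank x ≤ α} = samuelSet R α :=
  Set.ext fun x ↦ (mem_samuelSet_iff_samuelRank_le (h x)).symm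

/-- **Proposition 10.** «`A_α` is the union of `{0}` and the set of all `b ∈ A` such that the canonical map
`A_α′ → A/Ab` is surjective», with `A_α = {θ ≤ α}`, `A_α′ = {θ < α}`. [cite: Samuel1971, Prop. 10 (pp. 288–289)] -/
theorem setOf_samuelRank_le_eq_setOf_forall (h : ∀ x : R, ∃ α : Ordinal.{u}, x ∈ samuelSet R α)
    (α : Ordinal.{u}) :
    {x : R | samuelRank x ≤ α} = {b : R | b = 0 ∨ ∀ a : R, ∃ r : R, samuelRank r < α ∧ b ∣ a - r} := by
  ext b
  rw [Set.mem_setOf_eq, ← mem_samuelSet_iff_samuelRank_le (h b), mem_samuelSet_iff, Set.mem_setOf_eq]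
  refine or_congr_right (forall_congr' fun a ↦ ⟨?_, ?_⟩)
  · rintro ⟨β, hβ, r, hr, hd⟩
    exact ⟨r, (samuelRank_le_of_mem hr).trans_lt hβ, hd⟩
  · rintro ⟨r, hr, hd⟩
    exact ⟨samuelRank r, hr, r, mem_samuelSet_samuelRank (h r), hd⟩

/-- The comparison behind «the smallest algorithm»: if `φ : A → W` satisfies (E) and `g : W → Ordinal` is strictly
monotone (an order-embedding of the values into the ordinals — Samuel: «all the algorithms on the ring `A` may be
construed to take their values in the fixed ordered set `W`»), then `x ∈ A_{g(φ(x))}` (induction on `g(φ(x))`: the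
remainders mod `x` have smaller values). [cite: Samuel1971, §4 (p. 288) and Prop. 10 (p. 289)] -/
theorem mem_samuelSet_of_algorithm {W : Type*} [Preorder W] (φ : R → W)
    (hφ : ∀ a b : R, b ≠ 0 → ∃ q r : R, a = b * q + r ∧ φ r < φ b)
    (g : W → Ordinal.{u}) (hg : StrictMono g) (x : R) : x ∈ samuelSet R (g (φ x)) := by
  suffices H : ∀ o : Ordinal.{u}, ∀ x : R, g (φ x) = o → x ∈ samuelSet R o from H _ x rfl
  intro o
  induction o using WellFoundedLT.induction with
  | ind o ih =>
    intro x hxo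
    by_cases hx : x = 0
    · rw [hx]
      exact zero_mem_samuelSet o
    · refine mem_samuelSet_of_forall fun a ↦ ?_
      obtain ⟨q, r, hqr, hr⟩ := hφ a x hx
      exact ⟨g (φ r), hxo ▸ hg hr, r, ih _ (hxo ▸ hg hr) r rfl, ⟨q, by rw [hqr]; ring⟩⟩

/-- «the smallest algorithm (i.e. the infimum of all algorithms)»: `θ(x) ≤ g(φ(x))` for every algorithm `φ` and every
strictly monotone `g : W → Ordinal`. [cite: Samuel1971, §4 (p. 288)] -/
theorem samuelRank_le_of_algorithm {W : Type*} [Preorder W] (φ : R → W)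
    (hφ : ∀ a b : R, b ≠ 0 → ∃ q r : R, a = b * q + r ∧ φ r < φ b)
    (g : W → Ordinal.{u}) (hg : StrictMono g) (x : R) : samuelRank x ≤ g (φ x) :=
  samuelRank_le_of_mem (mem_samuelSet_of_algorithm φ hφ g hg x)

/-- `θ ≤ φ` for every ordinal-valued algorithm `φ`. [cite: Samuel1971, §4 (p. 288)] -/
theorem samuelRank_le_apply (φ : R → Ordinal.{u})
    (hφ : ∀ a b : R, b ≠ 0 → ∃ q r : R, a = b * q + r ∧ φ r < φ b) (x : R) : samuelRank x ≤ φ x :=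
  samuelRank_le_of_algorithm φ hφ id strictMono_id x

/-- `θ ≤ φ` for every `ℕ`-valued algorithm `φ` (an «ordinary» algorithm). [cite: Samuel1971, §4 (p. 288)] -/
theorem samuelRank_le_natCast (φ : R → ℕ)
    (hφ : ∀ a b : R, b ≠ 0 → ∃ q r : R, a = b * q + r ∧ φ r < φ b) (x : R) :
    samuelRank x ≤ (φ x : Ordinal.{u}) :=
  samuelRank_le_of_algorithm φ hφ (fun n : ℕ ↦ (n : Ordinal.{u})) Nat.strictMono_cast x

/-- `θ(x) ≤` the order type below `φ(x)`, for an algorithm with values in a well-ordered type `W` of the universe of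
`R` (Samuel's identification of `W` with an initial segment of the ordinals). [cite: Samuel1971, §4 (p. 288)] -/
theorem samuelRank_le_typein {W : Type u} [LinearOrder W] [WellFoundedLT W] (φ : R → W)
    (hφ : ∀ a b : R, b ≠ 0 → ∃ q r : R, a = b * q + r ∧ φ r < φ b) (x : R) :
    samuelRank x ≤ Ordinal.typein (α := W) (· < ·) (φ x) :=
  samuelRank_le_of_algorithm φ hφ (fun w ↦ Ordinal.typein (α := W) (· < ·) w)
    (fun _ _ h ↦ (Ordinal.typein_lt_typein (α := W) (· < ·)).2 h) x

/-- **«The ring `A` is Euclidean iff this sequence exhausts the ring `A`»** — for algorithms with values in the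
ordinals of the universe of `R` (any other well-ordered, indeed well-founded, value set is reduced to these by
`exists_ordinal_algorithm_of_algorithm`). [cite: Samuel1971, §4 (p. 289)] -/
theorem exists_algorithm_iff_forall_exists_mem_samuelSet :
    (∃ φ : R → Ordinal.{u}, ∀ a b : R, b ≠ 0 → ∃ q r : R, a = b * q + r ∧ φ r < φ b) ↔
      ∀ x : R, ∃ α : Ordinal.{u}, x ∈ samuelSet R α :=
  ⟨fun ⟨φ, hφ⟩ ↦ exists_mem_samuelSet_of_algorithm φ hφ, fun h ↦ ⟨samuelRank, samuelRank_isAlgorithm h⟩⟩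

/-- The criterion with a single stage: Euclidean iff `A_α = A` for some `α`. [cite: Samuel1971, §4 (p. 289)] -/
theorem exists_algorithm_iff_exists_samuelSet_eq_univ :
    (∃ φ : R → Ordinal.{u}, ∀ a b : R, b ≠ 0 → ∃ q r : R, a = b * q + r ∧ φ r < φ b) ↔
      ∃ α : Ordinal.{u}, samuelSet R α = Set.univ := by
  rw [exists_algorithm_iff_forall_exists_mem_samuelSet, exists_samuelSet_eq_univ_iff]

/-- An algorithm with values in ANY well-founded order (any universe) yields the ordinal-valued algorithm `θ`
(«all the algorithms on the ring `A` may be construed to take their values in the fixed ordered set `W` … we may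
assume that `W` is an ordinal»). [cite: Samuel1971, §4 (p. 288) and Prop. 11 (p. 290)] -/
theorem exists_ordinal_algorithm_of_algorithm {T : Type*} [LT T] [WellFoundedLT T] (φ : R → T)
    (hφ : ∀ a b : R, b ≠ 0 → ∃ q r : R, a = b * q + r ∧ φ r < φ b) :
    ∃ ψ : R → Ordinal.{u}, ∀ a b : R, b ≠ 0 → ∃ q r : R, a = b * q + r ∧ ψ r < ψ b :=
  ⟨samuelRank, samuelRank_isAlgorithm (exists_mem_samuelSet_of_algorithm φ hφ)⟩

/-- Prop. 4 (a) for the construction: if `ac ≠ 0` lies in `A_α` then so does `a` (the classes mod `Aa` are unions of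
classes mod `Aac`). [cite: Samuel1971, §4 (p. 288: «`θ` enjoys the properties described in Prop. 4»)] -/
theorem mem_samuelSet_of_mul_mem {a c : R} {α : Ordinal.{u}} (h : a * c ∈ samuelSet R α) (h0 : a * c ≠ 0) :
    a ∈ samuelSet R α := by
  refine mem_samuelSet_of_forall fun x ↦ ?_
  obtain ⟨β, hβ, r, hr, hd⟩ := forall_of_mem_samuelSet h h0 x
  exact ⟨β, hβ, r, hr, (dvd_mul_right a c).trans hd⟩

/-- **Prop. 4 (a) for `θ`**: «`θ(ac) ≥ θ(a)` for `ac ≠ 0`» (`ac ∈ A′`). [cite: Samuel1971, Prop. 4 (a) (p. 284) and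
§4 (p. 288)] -/
theorem samuelRank_le_samuelRank_mul {a c : R} (h : ∃ α : Ordinal.{u}, a * c ∈ samuelSet R α)
    (h0 : a * c ≠ 0) : samuelRank a ≤ samuelRank (a * c) :=
  samuelRank_le_of_mem (mem_samuelSet_of_mul_mem (mem_samuelSet_samuelRank h) h0)

/-- **Prop. 4 (b) for `θ`**: «`θ(ac) = θ(a)` iff `Aac = Aa`» (`ac ≠ 0`, `ac ∈ A′`; «only if»: write `a = acq + r`
with `θ(r) < θ(ac)`; `r = a(1 − cq)` would have `θ(r) ≥ θ(a)` by (a), so `r = 0`).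
[cite: Samuel1971, Prop. 4 (b) (p. 284) and §4 (p. 288)] -/
theorem samuelRank_mul_eq_iff {a c : R} (h : ∃ α : Ordinal.{u}, a * c ∈ samuelSet R α) (h0 : a * c ≠ 0) :
    samuelRank (a * c) = samuelRank a ↔ Ideal.span {a * c} = Ideal.span {a} := by
  have ha : ∃ α : Ordinal.{u}, a ∈ samuelSet R α :=
    let ⟨α, hα⟩ := h; ⟨α, mem_samuelSet_of_mul_mem hα h0⟩
  constructor
  · intro he
    obtain ⟨q, r, β, hβ, hr, hqr⟩ := exists_remainder_mem_samuelSet (mem_samuelSet_samuelRank h) h0 a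
    have hr' : r = a * (1 - c * q) := by linear_combination -hqr
    by_cases hr0 : r = 0
    · rw [hr0, add_zero] at hqr
      exact le_antisymm (Ideal.span_singleton_le_span_singleton.2 (dvd_mul_right a c))
        (Ideal.span_singleton_le_span_singleton.2 ⟨q, hqr⟩)
    · exfalso
      rw [hr'] at hr hr0
      have hle : samuelRank a ≤ β := samuelRank_le_of_mem (mem_samuelSet_of_mul_mem hr hr0)
      exact (hle.trans_lt hβ).ne he.symm
  · intro he
    -- `ac` and `a` generate the same ideal: they lie in the same stages
    have hdvd : a * c ∣ a := Ideal.span_singleton_le_span_singleton.1 he.ge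
    have key : ∀ α : Ordinal.{u}, a ∈ samuelSet R α → a * c ∈ samuelSet R α := fun α haα ↦
      mem_samuelSet_of_forall fun x ↦ by
        obtain ⟨β, hβ, r, hr, hd⟩ := forall_of_mem_samuelSet haα (left_ne_zero_of_mul h0) x
        exact ⟨β, hβ, r, hr, hdvd.trans hd⟩
    exact le_antisymm (samuelRank_le_of_mem (key _ (mem_samuelSet_samuelRank ha)))
      (samuelRank_le_samuelRank_mul h h0)

end Rank

/-! ## §5 The finite stages: Motzkin's sets, and `ℤ` -/

section Finite

variable {R : Type u} [CommRing R]

/-- **The finite stages are the complements of Motzkin's sets**: `A_n = R ∖ P₀^{(n)}` (`P₀ = R − 0`, `A₀ = {0}`;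
`b ∉ (P₀^{(n)})′` iff `b ∉ P₀^{(n)}` or some element of every class mod `b` is outside `P₀^{(n)}`, i.e. every class
meets `A_n`). [cite: Samuel1971, §4 (p. 289); Motzkin1949, §1 (p. 1143)] -/
theorem samuelSet_natCast (n : ℕ) : samuelSet R n = (motzkinSet n : Set R)ᶜ := by
  induction n with
  | zero =>
    rw [Nat.cast_zero, samuelSet_zero, motzkinSet_zero]
    ext b
    simp
  | succ n ih =>
    rw [Nat.cast_succ]
    ext b
    rw [mem_samuelSet_add_one_iff, ih, Set.mem_compl_iff, Set.mem_compl_iff, motzkinSet_succ,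
      mem_motzkinDerived, not_and_or]
    refine or_congr_right ?_
    push Not
    simp only [Set.mem_compl_iff]
    constructor
    · intro h a
      obtain ⟨r, hr, c, hc⟩ := h a
      refine ⟨-c, ?_⟩
      rw [show a + b * -c = r by linear_combination hc]
      exact hr
    · intro h a
      obtain ⟨q, hq⟩ := h a
      exact ⟨a + b * q, hq, ⟨-q, by ring⟩⟩

/-- The finite stages exhaust the ring iff Motzkin's criterion `⋂ₖ P₀^{(k)} = ∅` holds.
[cite: Samuel1971, §4 (p. 289); Motzkin1949, §1 (p. 1143)] -/
theorem iUnion_samuelSet_natCast_eq_univ_iff :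
    (⋃ n : ℕ, samuelSet R n) = Set.univ ↔ ∀ b : R, ∃ k : ℕ, b ∉ (motzkinSet k : Set R) := by
  simp only [Set.eq_univ_iff_forall, Set.mem_iUnion, samuelSet_natCast, Set.mem_compl_iff]

/-- A ring is Euclidean for an ordinary (`ℕ`-valued) algorithm — Motzkin's form, `a = bq + s` with `s = 0` or
`φ(s) < φ(b)` — iff the finite stages `A_n` of the transfinite construction exhaust it.
[cite: Samuel1971, §4 (p. 289); Motzkin1949, §1 (p. 1143)] -/
theorem exists_euclideanFunction_iff_iUnion_samuelSet_natCast :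
    (∃ φ : R → ℕ, ∀ a b : R, b ≠ 0 → ∃ q s : R, a = b * q + s ∧ (s = 0 ∨ φ s < φ b)) ↔
      (⋃ n : ℕ, samuelSet R n) = Set.univ := by
  rw [exists_euclideanFunction_iff_forall_exists_not_mem_motzkinSet, iUnion_samuelSet_natCast_eq_univ_iff]

/-- Under Motzkin's criterion the transfinite smallest algorithm is the finite one: `θ = motzkinRank` (the least `k`
with `x ∉ P₀^{(k)}` = the least `k` with `x ∈ A_k`). [cite: Samuel1971, §4 (4.3) (p. 289); Motzkin1949, §1 (p. 1143)] -/
theorem samuelRank_eq_natCast_motzkinRank (h : ∀ b : R, ∃ k : ℕ, b ∉ (motzkinSet k : Set R)) (x : R) :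
    samuelRank x = (motzkinRank h x : Ordinal.{u}) := by
  have hx : x ∈ samuelSet R (motzkinRank h x : ℕ) := by
    rw [samuelSet_natCast]
    exact not_mem_motzkinSet_motzkinRank h x
  refine (samuelRank_eq_iff ⟨_, hx⟩).2 ⟨hx, fun β hβ hβx ↦ ?_⟩
  obtain ⟨m, rfl⟩ := Ordinal.lt_omega0.1 (hβ.trans (Ordinal.natCast_lt_omega0 _))
  have hm : m < motzkinRank h x := by exact_mod_cast hβ
  rw [samuelSet_natCast] at hβx
  exact hβx (mem_motzkinSet_of_lt_motzkinRank h hm)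

/-- EXAMPLES (1), `ℤ`: `A_n = {b | |b| < 2ⁿ}` (from Motzkin's «`b ∈ P₀^{(k)}` iff `|b| ≥ 2ᵏ`»).
[cite: Samuel1971, §4 Examples (1) (p. 289)] -/
theorem Int.samuelSet_natCast_eq (n : ℕ) : samuelSet ℤ n = {b : ℤ | b.natAbs < 2 ^ n} := by
  rw [samuelSet_natCast, Int.motzkinSet_eq]
  ext b
  simp only [Set.mem_compl_iff, Set.mem_setOf_eq, not_le]

/-- The stages of `ℤ` are intervals: `b ∈ A_n ⟺ −2ⁿ < b < 2ⁿ` («consecutive integers»).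
[cite: Samuel1971, §4 Examples (1) (p. 289)] -/
theorem Int.mem_samuelSet_natCast_iff {n : ℕ} {b : ℤ} :
    b ∈ samuelSet ℤ n ↔ -(2 : ℤ) ^ n < b ∧ b < 2 ^ n := by
  rw [Int.samuelSet_natCast_eq, Set.mem_setOf_eq]
  have hm : ((2 ^ n : ℕ) : ℤ) = (2 : ℤ) ^ n := by push_cast; rfl
  rw [← hm]
  omega

/-- «For `A = ℤ`, we have `A₁′ = A₁ = {−1, 0, +1}`». [cite: Samuel1971, §4 Examples (1) (p. 289)] -/
theorem Int.samuelSet_one_eq : samuelSet ℤ 1 = {-1, 0, 1} := by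
  have h := Int.samuelSet_natCast_eq 1
  rw [Nat.cast_one] at h
  rw [h]
  ext b
  simp only [pow_one, Set.mem_setOf_eq, Set.mem_insert_iff, Set.mem_singleton_iff]
  omega

/-- «`A₂′ = A₂ = {−3, −2, −1, 0, 1, 2, 3}`». [cite: Samuel1971, §4 Examples (1) (p. 289)] -/
theorem Int.samuelSet_two_eq : samuelSet ℤ 2 = Set.Icc (-3) 3 := by
  have h := Int.samuelSet_natCast_eq 2
  rw [Nat.cast_ofNat] at h
  rw [h]
  ext b
  simp only [Set.mem_setOf_eq, Set.mem_Icc]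
  omega

/-- «`A₃′ = A₃` is the interval `[−7, +7]`». [cite: Samuel1971, §4 Examples (1) (p. 289)] -/
theorem Int.samuelSet_three_eq : samuelSet ℤ 3 = Set.Icc (-7) 7 := by
  have h := Int.samuelSet_natCast_eq 3
  rw [Nat.cast_ofNat] at h
  rw [h]
  ext b
  simp only [Set.mem_setOf_eq, Set.mem_Icc]
  omega

/-- «consisting of 15 consecutive integers». [cite: Samuel1971, §4 Examples (1) (p. 289)] -/
theorem Int.ncard_samuelSet_three : Set.ncard (samuelSet ℤ 3) = 15 := by
  rw [Int.samuelSet_three_eq, ← Finset.coe_Icc, Set.ncard_coe_finset, Int.card_Icc]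
  rfl

/-- The finite stages exhaust `ℤ`. [cite: Samuel1971, §4 Examples (1) (p. 289)] -/
theorem Int.iUnion_samuelSet_natCast : (⋃ n : ℕ, samuelSet ℤ n) = Set.univ :=
  iUnion_samuelSet_natCast_eq_univ_iff.2 Int.forall_exists_not_mem_motzkinSet

/-- Hence `A_ω = ℤ`. [cite: Samuel1971, §4 Examples (1) (p. 289)] -/
theorem Int.samuelSet_omega0 : samuelSet ℤ Ordinal.omega0 = Set.univ :=
  Set.eq_univ_of_univ_subset (Int.iUnion_samuelSet_natCast ▸ iUnion_samuelSet_natCast_subset)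

/-- **«the smallest algorithm `θ` on `ℤ` is given by `θ(n) =` number of binary digits of `|n|`»** (`Nat.size`).
[cite: Samuel1971, §4 Examples (1) (p. 289)] -/
theorem Int.samuelRank_eq (b : ℤ) : samuelRank b = (b.natAbs.size : Ordinal) := by
  have hb : b ∈ samuelSet ℤ (b.natAbs.size : ℕ) := by
    rw [Int.samuelSet_natCast_eq]
    exact Nat.lt_size_self _
  refine (samuelRank_eq_iff ⟨_, hb⟩).2 ⟨hb, fun β hβ hβb ↦ ?_⟩
  obtain ⟨m, rfl⟩ := Ordinal.lt_omega0.1 (hβ.trans (Ordinal.natCast_lt_omega0 _))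
  have hm : m < b.natAbs.size := by exact_mod_cast hβ
  rw [Int.samuelSet_natCast_eq, Set.mem_setOf_eq] at hβb
  exact absurd hβb (not_lt.2 (Nat.lt_size.1 hm))

end Finite

end Literature.Algebra.EuclideanDomain
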